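/-
Copyright (c) 2026 the pub-hodgecm-mathlib formalisation cell (harness21).  Prover seat hodgecm-mathlib-K2Liu-p14 (g2): Track B «K2-LIT»,
hLiu418 = stmt-HodgeConjecture-24832; K2E5-plan (g7) 10:32:10Z «(β4-v) IS YOURS» (LEAD F0P6-plan lineage RULING M-157b (β4)), file (β4-v) D2b.
-/
import Summits.HodgeConjecture.HodgeConjecture.Theorems.K2LiuUnitaryFlatSpaceGodementData   -- ★ (β4-v) D1 (arch package)
import Summits.HodgeConjecture.HodgeConjecture.Theorems.K2LiuGL2FlatSectionFiniteData      -- ★ (β4-v) D2a (finite-adelic coefficients)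
import Literature.NumberTheory.Automorphic.UnitaryGroupBorelSiegelSet                      -- ★ `toMixed_mem_Kinf_of_mem_standardMaximalCompactGL` & co.
import HarnessLib

/-!
# Crux `HLiu418`, road `K2_Liu`, Road Φ organ G5 (β) «Godement sections exhaust», file (β4-v) D2b:
# THE GODEMENT DATA OF A FLAT `K`-FINITE FUNCTION ON `K = K_∞·GL₂(𝒪̂_L)` — the (hK, hgi, hAinv, hfin) faces of ★ (β4-iii) `exists_godement_exhaust` DISCHARGED

Cell `hodgecm-mathlib`, crux item hLiu418 = `stmt-HodgeConjecture-24832`; prover K2Liu-p14 (g2).  THEOREMS ONLY (no `def`, no instance, no notation,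
no named-fact hypothesis, no `sorry`); lane `--supports stmt-HodgeConjecture-24832` (count-neutral helper).  `L` totally complex.
INPUT (the restriction to `K = standardMaximalCompactGL 2 L` of a flat `K`-finite section, RULING M-157b (β4)): `B : GL₂(𝔸_L) → ℂ` with `hBK` (left invariance
under the upper-triangular elements of `K` on `K`), `hlev` (right invariance on `K` under `K′_f = ∏_{v∈S} K_{γ_v} × ∏_{v∉S} GL₂(𝒪_v)`), `hcont` (continuous on `K`) and `hfin`
(the right `K`-translates of `B|_K` span a finite-dimensional space).  THE SPLIT (§1–§2): `k = ι_∞(k_∞)·ι_f(k_f)` (★ `GLn.ofInfinite_toMixed_mul_ofFinite_sndHom`), and the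
span `W` of the archimedean slices `u ↦ B(ι_∞ u · k₀)` (`k₀ ∈ K`) is finite-dimensional (image of `hfin`'s span), right-`K_∞`-stable, continuous and flat, so ★ (β4-v) D1
`K2LiuUnitaryFlatSpaceGodementData.exists_basis_godement_data` gives `B(k) = Σ_i βf_i(k_f) · e_i(k_∞)` with `βf_i(k_f) = Σ_x c_i(x) B(ι_∞ x · ι_f k_f)` and the
archimedean Godement data of each `e_i`; ★ (β4-v) D2a `K2LiuGL2FlatSectionFiniteData.exists_finiteAdelic_schwartzBruhat_of_flat_combination` gives the Schwartz–Bruhat data of each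
`βf_i`.  OUTPUT MAIN **`exists_godement_data`**: `N`, `ι_i`, `Φinf_{i,m}`, `A_{i,m}`, `Φfin_i`, `βf_i` with `Φfin_i ∈ SchwartzBruhat`, `(A_{i,m} w)⁻¹` ENTIRE, the arch
integrands integrable, `Φfin_i(a_f · e₂ k_f) = 𝟙_D(a) βf_i(k_f)`, and ON `K`:
  `B k = Σ_i (Σ_{m ∈ ι_i} (A_{i,m} w)⁻¹ ∫_{K_∞ˣ} Φinf_{i,m}(x · e₂ k_∞) N(x)^w dμ(x)) · βf_i(k_f)`   (`0 < re w`; `k_∞ = GLn.toMixed 2 L k`, `k_f = GLn.sndHom 2 L k`)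
— after reindexing over `Σ_i ι_i`, LITERALLY the hK∕hgi∕hAinv∕hfin binders of ★ `exists_godement_exhaust` at `w = 2s+1` ((β4-v) E).
[cite: JacquetLanglands1970, §3, §5–§6, §11] [cite: MoeglinWaldspurger1995, II.1.7] [cite: BorelJacquet1979, §4.1] [cite: Bump1997, §3.7] [cite: CogdellAnalyticTheory2004, §2.3].
HONEST LABEL.  `HC_CM` is proved only modulo the 7 printed citations (2 remaining named inputs: hLiu418 = `stmt-HodgeConjecture-24832`,
h413 = `stmt-HodgeConjecture-24833`) until rung 0 closes.
-/

set_option autoImplicit false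
set_option linter.dupNamespace false -- the mandated namespace repeats `HodgeConjecture.HodgeConjecture`

noncomputable section

open MeasureTheory Measure NumberField NumberField.InfinitePlace NumberField.mixedEmbedding IsDedekindDomain
open scoped NNReal ENNReal Classical Matrix
open Literature.NumberTheory.Automorphic
open Literature.NumberTheory.GaloisRepresentations (ideleGroup)
open Summit.HodgeConjecture.HodgeConjecture.Cruxes.HLiu418.K2LiuUnitaryFlatSpaceGodementData (exists_basis_godement_data)
open Summit.HodgeConjecture.HodgeConjecture.Cruxes.HLiu418.K2LiuGL2FlatSectionFiniteData

namespace Summit.HodgeConjecture.HodgeConjecture.Cruxes.HLiu418.K2LiuGL2FlatSectionGodementData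

variable {L : Type} [Field L] [NumberField L]

/-! ## §1 `K = ι_∞(K_∞) · ι_f(GL₂(𝒪̂_L))` -/

/-- `ι_∞` is multiplicative on `U(2, mixedSpace L)`. [folklore] -/
theorem ofInfinite_unitary_mul (u u' : Matrix.unitaryGroup (Fin 2) (mixedSpace L)) :
    GLn.ofInfinite 2 L ⟨((u * u' : Matrix.unitaryGroup (Fin 2) (mixedSpace L)) : Matrix (Fin 2) (Fin 2) (mixedSpace L)),
        star ((u * u' : Matrix.unitaryGroup (Fin 2) (mixedSpace L)) : Matrix (Fin 2) (Fin 2) (mixedSpace L)),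
        Matrix.mem_unitaryGroup_iff.1 (u * u').2, Matrix.mem_unitaryGroup_iff'.1 (u * u').2⟩ =
      GLn.ofInfinite 2 L ⟨(u : Matrix (Fin 2) (Fin 2) (mixedSpace L)), star (u : Matrix (Fin 2) (Fin 2) (mixedSpace L)),
          Matrix.mem_unitaryGroup_iff.1 u.2, Matrix.mem_unitaryGroup_iff'.1 u.2⟩ *
        GLn.ofInfinite 2 L ⟨(u' : Matrix (Fin 2) (Fin 2) (mixedSpace L)), star (u' : Matrix (Fin 2) (Fin 2) (mixedSpace L)),
          Matrix.mem_unitaryGroup_iff.1 u'.2, Matrix.mem_unitaryGroup_iff'.1 u'.2⟩ := by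
  rw [← map_mul]
  exact congrArg _ (Units.ext rfl)

/-- `u ↦ ι_∞ u` is continuous on `U(2, mixedSpace L)`. [folklore] -/
theorem continuous_ofInfinite_unitary : Continuous fun u : Matrix.unitaryGroup (Fin 2) (mixedSpace L) =>
    GLn.ofInfinite 2 L ⟨(u : Matrix (Fin 2) (Fin 2) (mixedSpace L)), star (u : Matrix (Fin 2) (Fin 2) (mixedSpace L)),
      Matrix.mem_unitaryGroup_iff.1 u.2, Matrix.mem_unitaryGroup_iff'.1 u.2⟩ := by
  refine (GLn.continuous_ofInfinite 2 L).comp (Units.continuous_iff.2 ⟨continuous_subtype_val, ?_⟩)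
  exact continuous_star.comp continuous_subtype_val

/-- the archimedean component of `k ∈ K` is unitary: `(GLn.toMixed 2 L k : Matrix) ∈ U(2, mixedSpace L)`. [cite: BorelJacquet1979, §4.1] -/
theorem coe_toMixed_mem_unitaryGroup {k : GL (Fin 2) (AdeleRing (𝓞 L) L)} (hk : k ∈ standardMaximalCompactGL 2 L) :
    ((GLn.toMixed 2 L k : GL (Fin 2) (mixedSpace L)) : Matrix (Fin 2) (Fin 2) (mixedSpace L)) ∈ Matrix.unitaryGroup (Fin 2) (mixedSpace L) := by
  have h := toMixed_mem_Kinf_of_mem_standardMaximalCompactGL hk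
  rw [Kinf_eq_unitarySubgroupGL, mem_unitarySubgroupGL_iff_coe_mem_unitaryGroup] at h
  exact h

/-- **`k = ι_∞(k_∞) · ι_f(k_f)`** for `k ∈ K`, with `k_∞ = GLn.toMixed 2 L k` read in `U(2, mixedSpace L)` and `k_f = GLn.sndHom 2 L k`
(★ `GLn.ofInfinite_toMixed_mul_ofFinite_sndHom`). [cite: BorelJacquet1979, §4.1] -/
theorem eq_ofInfinite_mul_ofFinite {k : GL (Fin 2) (AdeleRing (𝓞 L) L)} (hk : k ∈ standardMaximalCompactGL 2 L) :
    k = GLn.ofInfinite 2 L ⟨(((⟨_, coe_toMixed_mem_unitaryGroup hk⟩ : Matrix.unitaryGroup (Fin 2) (mixedSpace L)) :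
          Matrix.unitaryGroup (Fin 2) (mixedSpace L)) : Matrix (Fin 2) (Fin 2) (mixedSpace L)),
        star (((⟨_, coe_toMixed_mem_unitaryGroup hk⟩ : Matrix.unitaryGroup (Fin 2) (mixedSpace L)) :
          Matrix.unitaryGroup (Fin 2) (mixedSpace L)) : Matrix (Fin 2) (Fin 2) (mixedSpace L)),
        Matrix.mem_unitaryGroup_iff.1 (⟨_, coe_toMixed_mem_unitaryGroup hk⟩ : Matrix.unitaryGroup (Fin 2) (mixedSpace L)).2,
        Matrix.mem_unitaryGroup_iff'.1 (⟨_, coe_toMixed_mem_unitaryGroup hk⟩ : Matrix.unitaryGroup (Fin 2) (mixedSpace L)).2⟩ *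
      GLn.ofFinite 2 L (GLn.sndHom 2 L k) := by
  conv_lhs => rw [← GLn.ofInfinite_toMixed_mul_ofFinite_sndHom (n := 2) (K := L) k]
  congr 2
  exact Units.ext rfl

/-! ## §2 MAIN: the Godement data of a flat `K`-finite function on `K` -/

variable [IsTotallyComplex L]

/-- **THE GODEMENT DATA OF A FLAT `K`-FINITE FUNCTION ON `K`** — the (hK, hgi, hAinv, hfin) faces of ★ (β4-iii) `exists_godement_exhaust`, DISCHARGED (RULING M-157b (β4):
«a `K`-finite flat global section is a FINITE sum of pure tensors — no restricted-tensor-product theory»).  See the module docstring for the letters.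
[cite: JacquetLanglands1970, §3, §5–§6, §11] [cite: MoeglinWaldspurger1995, II.1.7] [cite: BorelJacquet1979, §4.1] [cite: Bump1997, §3.7] -/
theorem exists_godement_data (μ : Measure (mixedSpace L)ˣ) [μ.IsHaarMeasure]
    (S : Finset (HeightOneSpectrum (𝓞 L))) (γ : ∀ v : HeightOneSpectrum (𝓞 L), ValuativeRel.ValueGroupWithZero (v.adicCompletion L))
    (hγ0 : ∀ v ∈ S, γ v ≠ 0) (hγ1 : ∀ v ∈ S, γ v < 1) (B : GL (Fin 2) (AdeleRing (𝓞 L) L) → ℂ)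
    (hBK : ∀ p ∈ standardMaximalCompactGL 2 L, ∀ k ∈ standardMaximalCompactGL 2 L,
      (p : Matrix (Fin 2) (Fin 2) (AdeleRing (𝓞 L) L)) 1 0 = 0 → B (p * k) = B k)
    (hlev : ∀ k ∈ standardMaximalCompactGL 2 L, ∀ r ∈ glFiniteIntegralLevel 2 L, (∀ v ∈ S, GLn.evalAt 2 L v r ∈ congruenceGL 2 (γ v)) →
      B (k * GLn.ofFinite 2 L r) = B k)
    (hcont : Continuous fun k : ↥(standardMaximalCompactGL 2 L) => B k)
    (hfin : FiniteDimensional ℂ (Submodule.span ℂ (Set.range fun k₀ : ↥(standardMaximalCompactGL 2 L) =>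
      fun k : ↥(standardMaximalCompactGL 2 L) => B ((k : GL (Fin 2) (AdeleRing (𝓞 L) L)) * k₀)))) :
    ∃ (N : ℕ) (ι : Fin N → Finset ((({v : InfinitePlace L // v.IsComplex} × Fin 2) ⊕ ({v : InfinitePlace L // v.IsComplex} × Fin 2)) →₀ ℕ))
      (Φinf : Fin N → ((({v : InfinitePlace L // v.IsComplex} × Fin 2) ⊕ ({v : InfinitePlace L // v.IsComplex} × Fin 2)) →₀ ℕ) →
        SchwartzMap (Fin 2 → mixedSpace L) ℂ)
      (A : Fin N → ((({v : InfinitePlace L // v.IsComplex} × Fin 2) ⊕ ({v : InfinitePlace L // v.IsComplex} × Fin 2)) →₀ ℕ) → ℂ → ℂ)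
      (Φfin : Fin N → (Fin 2 → FiniteAdeleRing (𝓞 L) L) → ℂ) (βf : Fin N → GL (Fin 2) (FiniteAdeleRing (𝓞 L) L) → ℂ),
      (∀ i, Φfin i ∈ SchwartzBruhat (Fin 2 → FiniteAdeleRing (𝓞 L) L)) ∧
      (∀ i m, Differentiable ℂ fun w : ℂ => (A i m w)⁻¹) ∧
      (∀ i, ∀ m ∈ ι i, ∀ w : ℂ, 0 < w.re → ∀ k ∈ standardMaximalCompactGL 2 L,
        Integrable (fun x : (mixedSpace L)ˣ => Φinf i m (fun l => (x : mixedSpace L) *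
            ((GLn.toMixed 2 L k : GL (Fin 2) (mixedSpace L)) : Matrix (Fin 2) (Fin 2) (mixedSpace L)) 1 l) *
          ((mixedEmbedding.norm ((x : (mixedSpace L)ˣ) : mixedSpace L) : ℝ) : ℂ) ^ w) μ) ∧
      (∀ (i : Fin N) (a : ideleGroup L) (kf : GL (Fin 2) (FiniteAdeleRing (𝓞 L) L)), kf ∈ glFiniteIntegralLevel 2 L →
        Φfin i (fun l => ((a : ideleGroup L) : AdeleRing (𝓞 L) L).2 * (kf : Matrix (Fin 2) (Fin 2) (FiniteAdeleRing (𝓞 L) L)) 1 l) =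
          {a : ideleGroup L | (∀ v ∈ S, Valued.v (((a : ideleGroup L) : AdeleRing (𝓞 L) L).2 v) = 1) ∧
              ∀ v, v ∉ S → Valued.v (((a : ideleGroup L) : AdeleRing (𝓞 L) L).2 v) ≤ 1}.indicator (fun _ => (1 : ℂ)) a * βf i kf) ∧
      ∀ w : ℂ, 0 < w.re → ∀ k ∈ standardMaximalCompactGL 2 L,
        B k = ∑ i, (∑ m ∈ ι i, (A i m w)⁻¹ * ∫ x : (mixedSpace L)ˣ, Φinf i m (fun l => (x : mixedSpace L) *
              ((GLn.toMixed 2 L k : GL (Fin 2) (mixedSpace L)) : Matrix (Fin 2) (Fin 2) (mixedSpace L)) 1 l) *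
            ((mixedEmbedding.norm ((x : (mixedSpace L)ˣ) : mixedSpace L) : ℝ) : ℂ) ^ w ∂μ) * βf i (GLn.sndHom 2 L k) := by
  -- the embedding `ι_∞ : U(2, mixedSpace L) → K`
  set ιu : Matrix.unitaryGroup (Fin 2) (mixedSpace L) → ↥(standardMaximalCompactGL 2 L) := fun u =>
    ⟨GLn.ofInfinite 2 L ⟨(u : Matrix (Fin 2) (Fin 2) (mixedSpace L)), star (u : Matrix (Fin 2) (Fin 2) (mixedSpace L)),
      Matrix.mem_unitaryGroup_iff.1 u.2, Matrix.mem_unitaryGroup_iff'.1 u.2⟩, ofInfinite_unitary_mem u⟩ with hιu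
  have hιu_mul : ∀ u u' : Matrix.unitaryGroup (Fin 2) (mixedSpace L),
      ((ιu (u * u') : ↥(standardMaximalCompactGL 2 L)) : GL (Fin 2) (AdeleRing (𝓞 L) L)) = (ιu u : GL (Fin 2) (AdeleRing (𝓞 L) L)) * ιu u' :=
    fun u u' => ofInfinite_unitary_mul u u'
  have hιu_cont : Continuous ιu := continuous_ofInfinite_unitary.subtype_mk _
  -- the span `W` of the archimedean slices
  set W : Submodule ℂ (Matrix.unitaryGroup (Fin 2) (mixedSpace L) → ℂ) := Submodule.span ℂ (Set.range
    fun k₀ : ↥(standardMaximalCompactGL 2 L) => fun u : Matrix.unitaryGroup (Fin 2) (mixedSpace L) =>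
      B ((ιu u : GL (Fin 2) (AdeleRing (𝓞 L) L)) * k₀)) with hW
  haveI hWfin : FiniteDimensional ℂ W := by
    have heq : W = (Submodule.span ℂ (Set.range fun k₀ : ↥(standardMaximalCompactGL 2 L) =>
        fun k : ↥(standardMaximalCompactGL 2 L) => B ((k : GL (Fin 2) (AdeleRing (𝓞 L) L)) * k₀))).map (LinearMap.funLeft ℂ ℂ ιu) := by
      rw [hW, Submodule.map_span, ← Set.range_comp]
      rfl
    rw [heq]
    infer_instance
  have hWright : ∀ g ∈ W, ∀ u₀ : Matrix.unitaryGroup (Fin 2) (mixedSpace L), (fun u => g (u * u₀)) ∈ W := by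
    intro g hg u₀
    induction hg using Submodule.span_induction with
    | mem g hg =>
      obtain ⟨k₀, rfl⟩ := hg
      refine Submodule.subset_span ⟨⟨(ιu u₀ : GL (Fin 2) (AdeleRing (𝓞 L) L)) * k₀, Subgroup.mul_mem _ (ιu u₀).2 k₀.2⟩, funext fun u => ?_⟩
      simp only [hιu_mul, mul_assoc]
    | zero => exact Submodule.zero_mem _
    | add g g' _ _ hg hg' => exact Submodule.add_mem _ hg hg'
    | smul a g _ hg => exact Submodule.smul_mem _ a hg
  have hWcont : ∀ g ∈ W, Continuous g := by
    intro g hg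
    induction hg using Submodule.span_induction with
    | mem g hg =>
      obtain ⟨k₀, rfl⟩ := hg
      exact hcont.comp (Continuous.subtype_mk (f := fun u : Matrix.unitaryGroup (Fin 2) (mixedSpace L) =>
        (ιu u : GL (Fin 2) (AdeleRing (𝓞 L) L)) * (k₀ : GL (Fin 2) (AdeleRing (𝓞 L) L)))
        ((continuous_subtype_val.comp hιu_cont).mul continuous_const) fun u => Subgroup.mul_mem _ (ιu u).2 k₀.2)
    | zero => exact continuous_const
    | add g g' _ _ hg hg' => exact hg.add hg'
    | smul a g _ hg => exact hg.const_smul a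
  have hWflat : ∀ g ∈ W, ∀ p k : Matrix.unitaryGroup (Fin 2) (mixedSpace L), (p : Matrix (Fin 2) (Fin 2) (mixedSpace L)) 1 0 = 0 → g (p * k) = g k := by
    intro g hg p k hp
    induction hg using Submodule.span_induction with
    | mem g hg =>
      obtain ⟨k₀, rfl⟩ := hg
      simp only [hιu_mul, mul_assoc]
      exact hBK _ (ιu p).2 _ (Subgroup.mul_mem _ (ιu k).2 k₀.2) (ofInfinite_unitary_apply_one_zero hp)
    | zero => rfl
    | add g g' _ _ hg hg' => simp only [Pi.add_apply, hg, hg']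
    | smul a g _ hg => simp only [Pi.smul_apply, hg]
  -- ★ D1: basis, evaluation coordinates, archimedean Godement data
  obtain ⟨N, e, c, ι, Φ, A, hexp, hAinv, hgi, hval⟩ := exists_basis_godement_data μ W hWright hWcont hWflat
  -- ★ D2a: the Schwartz–Bruhat data of the finite-adelic coefficients
  choose Φfin hΦfin hfinval using fun i => exists_finiteAdelic_schwartzBruhat_of_flat_combination B S γ hγ0 hγ1 hBK hlev (c i)
  refine ⟨N, ι, Φ, A, Φfin, fun i kf => (c i).sum fun x a => a * B (GLn.ofInfinite 2 L ⟨(x : Matrix (Fin 2) (Fin 2) (mixedSpace L)),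
      star (x : Matrix (Fin 2) (Fin 2) (mixedSpace L)), Matrix.mem_unitaryGroup_iff.1 x.2, Matrix.mem_unitaryGroup_iff'.1 x.2⟩ * GLn.ofFinite 2 L kf),
    hΦfin, hAinv, fun i m hm w hw k hk => hgi i m hm w hw ⟨_, coe_toMixed_mem_unitaryGroup hk⟩, hfinval, fun w hw k hk => ?_⟩
  -- the identity on `K`
  have hg : (fun u : Matrix.unitaryGroup (Fin 2) (mixedSpace L) => B (GLn.ofInfinite 2 L ⟨(u : Matrix (Fin 2) (Fin 2) (mixedSpace L)),
      star (u : Matrix (Fin 2) (Fin 2) (mixedSpace L)), Matrix.mem_unitaryGroup_iff.1 u.2, Matrix.mem_unitaryGroup_iff'.1 u.2⟩ *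
        GLn.ofFinite 2 L (GLn.sndHom 2 L k))) ∈ W :=
    Submodule.subset_span ⟨⟨GLn.ofFinite 2 L (GLn.sndHom 2 L k), ofFinite_mem (sndHom_mem_of_mem_standardMaximalCompactGL hk)⟩, rfl⟩
  have h1 := hexp _ hg ⟨_, coe_toMixed_mem_unitaryGroup hk⟩
  beta_reduce at h1
  conv_lhs => rw [eq_ofInfinite_mul_ofFinite hk, h1]
  refine Finset.sum_congr rfl fun i _ => ?_
  rw [hval i w hw ⟨_, coe_toMixed_mem_unitaryGroup hk⟩]
  beta_reduce
  ring

end Summit.HodgeConjecture.HodgeConjecture.Cruxes.HLiu418.K2LiuGL2FlatSectionGodementData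

end
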